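import Literature.MathematicalPhysics.QuantumFieldTheory.Balaban1983to89.T3YM3TorusStatement
import Literature.MathematicalPhysics.QuantumFieldTheory.Balaban1983to89.T3ContinuumYM3TorusNonempty
import Literature.MathematicalPhysics.QuantumFieldTheory.Balaban1983to89.T3CovarianceRP
import Literature.MathematicalPhysics.QuantumFieldTheory.LatticeLangevinDynamics
import Literature.MathematicalPhysics.QuantumFieldTheory.WilsonEnergyConvexity
import Literature.MathematicalPhysics.QuantumLattice.RepLieAlgebraUnitary
import HarnessLib

/-!
# Route `ColdStartUniversality`, crux K_A1 `UniformColdStartMixing` (stmt-QuantumFields-24809), rung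
# `stub_fixedCutoffMixing`: the Gibbs dictionary — Bałaban's step-`K` expectation `expectAt` IS the
# SZZ/Wilson measure `wilsonMeasure (fundamentalRep (Fin 2)) (β_K/2)` read through the bond dictionary

Helper file (lead `ym-line-csu-p1`).  Discharges input (D) `hyp_dictionary` of the rung workfile
`Cruxes/UniformColdStartMixing/Lines/rung_fixedCutoffMixing.lean` (and the same identification is what
every crux of the route needs to compare the dynamics with `expectAt`):

* `plaqHol_pullback` — under the bond dictionary `V b := U (b.src, b.dir)` Bałaban's plaquette variable
  `plaqHol V p` (Setup (9)) is the tree's `plaquetteHolonomy U p.src p.μ p.ν` (same ordering; Bałaban's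
  `Site.shift = Function.update x μ (x μ + 1)` is `x + Pi.single μ 1`);
* `mul_wilsonAction4_pullback` — `β · A(V) = (β/2) · S_ρ(U)` for `G = SU(2)`: Bałaban's normalised trace
  `reTr = Re Tr / 2` (`UnitaryModel`) and unit plaquette weight versus the tree's `Σ_p (2 − Re tr ρ(U_p))`,
  over the same plaquette set `{(x, μ < ν)}` (`Plaq P 0 ≃ Plaquette d N`);
* `measurePreserving_pullback` — the dictionary carries `⊗_{Edge} Haar` to Bałaban's `fieldMeasure = ⊗_{PBond} Haar`
  (`HaarData.haar = haarProbability` on `SU(2)` by `rfl`);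
* `expect_eq_integral_wilsonMeasure` — hence `expect P β f = ∫ f(U ∘ dict) d(wilsonMeasure ρ (β/2))` for EVERY
  `f` and every real `β` (both sides are `∫ f e^{−βA} / ∫ e^{−βA}`; the tree's `wilsonExpectation_eq_integral_div`);
* `expectAt_eq_integral_wilsonMeasure` — the rung's hypothesis (D) verbatim: for every `F`, `γ`, `K`, `os`,
  `expectAt K os = ∫ (∏_{C∈os} avgObs K C (b ↦ U (b.src, b.dir))) d(wilsonMeasure (fundamentalRep (Fin 2)) ((γ ε_K)⁻¹/2))(U)`.

No definition, no sorry, standard axioms.  RECORD-rung plumbing; nothing here bears on the mass gap.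
-/

set_option autoImplicit false

noncomputable section

namespace Summit.QuantumFields.YangMills.Theorems.ColdStartUniversality

open MeasureTheory Finset
open scoped BigOperators
open Literature.MathematicalPhysics.QuantumFieldTheory
open Literature.MathematicalPhysics.QuantumLattice (fundamentalRep fundamentalLatticeRep continuous_fundamentalRep)
open Literature.MathematicalPhysics.QuantumFieldTheory.Balaban1983to89

section General

variable (P : Params) {G : Type*}

/-- Bałaban's lattice step `x ↦ x + e_μ` (`Function.update x μ (x μ + 1)`) is the tree's `x + Pi.single μ 1`.
[folklore] -/
theorem balabanShift_eq_shift (x : Site P 0) (μ : Fin P.d) :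
    Balaban1983to89.Site.shift x μ =
      Literature.MathematicalPhysics.QuantumFieldTheory.Site.shift (d := P.d) (L := P.sitesPerDir 0) x μ := by
  unfold Balaban1983to89.Site.shift Literature.MathematicalPhysics.QuantumFieldTheory.Site.shift
  funext ν
  rw [Pi.add_apply]
  by_cases h : ν = μ
  · subst h; simp
  · simp [Function.update_of_ne h, Pi.single_eq_of_ne h]

/-- **The plaquette variables agree under the bond dictionary**: `plaqHol (b ↦ U (b.src, b.dir)) p =
plaquetteHolonomy U p.src p.μ p.ν`. [folklore] -/
theorem plaqHol_pullback [GaugeGroup G] (U : GaugeConfig P.d (P.sitesPerDir 0) G) (p : Plaq P 0) :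
    GaugeField.plaqHol (fun b : PBond P 0 => U (b.src, b.dir)) p = plaquetteHolonomy U p.src p.μ p.ν := by
  simp only [GaugeField.plaqHol, plaquetteHolonomy, balabanShift_eq_shift]

/-- **Sums over Bałaban's plaquettes are sums over the tree's plaquettes** (`Plaq P 0 ≃ Plaquette d N`,
`⟨x, μ, ν, μ<ν⟩ ↦ (x, ⟨(μ, ν), μ<ν⟩)`). [folklore] -/
theorem sum_plaq_eq_sum_plaquette (g : Site P 0 → Fin P.d → Fin P.d → ℝ) :
    ∑ p : Plaq P 0, g p.src p.μ p.ν =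
      ∑ q : Plaquette P.d (P.sitesPerDir 0), g q.1 q.2.1.1 q.2.1.2 := by
  refine Fintype.sum_equiv ⟨fun p => (p.src, ⟨(p.μ, p.ν), p.hμν⟩), fun q => ⟨q.1, q.2.1.1, q.2.1.2, q.2.2⟩,
    fun _ => rfl, fun _ => rfl⟩ _ _ fun _ => rfl

/-- **The bond dictionary is measure preserving**: it carries `⊗_{Edge} Haar` to Bałaban's
`fieldMeasure P 0 G = ⊗_{PBond} Haar`. [folklore] -/
theorem measurePreserving_pullback [GaugeGroup G] [MeasurableSpace G] [HaarData G] :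
    MeasurePreserving (fun U : GaugeConfig P.d (P.sitesPerDir 0) G => (fun b : PBond P 0 => U (b.src, b.dir) : GaugeField P 0 G))
      (Measure.pi fun _ : Edge P.d (P.sitesPerDir 0) => (HaarData.haar : Measure G)) (fieldMeasure P 0 G) := by
  haveI : IsProbabilityMeasure (HaarData.haar : Measure G) := HaarData.isProb
  let e : PBond P 0 ≃ Edge P.d (P.sitesPerDir 0) := ⟨fun b => (b.src, b.dir), fun x => ⟨x.1, x.2⟩, fun _ => rfl, fun _ => rfl⟩
  have h := (measurePreserving_piCongrLeft (fun _ : Edge P.d (P.sitesPerDir 0) => (HaarData.haar : Measure G)) e).symm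
  have hcoe : ⇑((MeasurableEquiv.piCongrLeft (fun _ : Edge P.d (P.sitesPerDir 0) => G) e).symm) =
      fun U : GaugeConfig P.d (P.sitesPerDir 0) G => (fun b : PBond P 0 => U (b.src, b.dir) : GaugeField P 0 G) := by
    funext U b
    rfl
  rw [hcoe] at h
  exact h

/-- Change of variables along the dictionary: `∫ g(U ∘ dict) d(⊗_{Edge} Haar) = ∫ g d(fieldMeasure)` for every `g`.
[folklore] -/
theorem integral_pullback [GaugeGroup G] [MeasurableSpace G] [HaarData G] (g : GaugeField P 0 G → ℝ) :
    ∫ U, g (fun b : PBond P 0 => U (b.src, b.dir))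
        ∂(Measure.pi fun _ : Edge P.d (P.sitesPerDir 0) => (HaarData.haar : Measure G)) =
      ∫ V, g V ∂(fieldMeasure P 0 G) := by
  haveI : IsProbabilityMeasure (HaarData.haar : Measure G) := HaarData.isProb
  let e : PBond P 0 ≃ Edge P.d (P.sitesPerDir 0) := ⟨fun b => (b.src, b.dir), fun x => ⟨x.1, x.2⟩, fun _ => rfl, fun _ => rfl⟩
  have h := (measurePreserving_piCongrLeft (fun _ : Edge P.d (P.sitesPerDir 0) => (HaarData.haar : Measure G)) e).symm
  have := h.integral_comp' (f := (MeasurableEquiv.piCongrLeft (fun _ : Edge P.d (P.sitesPerDir 0) => G) e).symm) g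
  exact this

end General

/-! ### `SU(2)`: the action dictionary and the expectation dictionary -/

section SU2

variable (P : Params)

/-- Bałaban's normalised trace on `SU(2)` is `Re Tr / 2`. [folklore] -/
theorem reTr_su2 (g : Matrix.specialUnitaryGroup (Fin 2) ℂ) :
    reTr g = ((g : Matrix (Fin 2) (Fin 2) ℂ).trace.re) / 2 := by
  change UnitaryModel.nReTr ((fundamentalRep (Fin 2)) g) = _
  simp [UnitaryModel.nReTr, fundamentalRep]

/-- **The action dictionary**: `β · A(U ∘ dict) = (β/2) · S_{fundamental}(U)` (`A` Bałaban's unit-weight Wilson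
action with normalised trace, `S` the tree's `Σ_p (2 − Re tr U_p)`). [folklore] -/
theorem mul_wilsonAction4_pullback (β : ℝ)
    (U : GaugeConfig P.d (P.sitesPerDir 0) (Matrix.specialUnitaryGroup (Fin 2) ℂ)) :
    β * wilsonAction4 (fun b : PBond P 0 => U (b.src, b.dir)) =
      β / 2 * wilsonAction (d := P.d) (L := P.sitesPerDir 0) (fundamentalRep (Fin 2)) U := by
  unfold wilsonAction4 Balaban1983to89.wilsonAction Literature.MathematicalPhysics.QuantumFieldTheory.wilsonAction
  simp only [one_mul, plaqHol_pullback, reTr_su2]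
  rw [sum_plaq_eq_sum_plaquette P (fun x μ ν => 1 - ((plaquetteHolonomy U x μ ν : Matrix.specialUnitaryGroup (Fin 2) ℂ) :
      Matrix (Fin 2) (Fin 2) ℂ).trace.re / 2), Finset.mul_sum, Finset.mul_sum]
  refine Finset.sum_congr rfl fun q _ => ?_
  simp [fundamentalRep]
  ring

/-- The Boltzmann weights agree: `e^{−β A(U ∘ dict)} = e^{−(β/2) S(U)}`. [folklore] -/
theorem boltzmann_pullback (β : ℝ) (U : GaugeConfig P.d (P.sitesPerDir 0) (Matrix.specialUnitaryGroup (Fin 2) ℂ)) :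
    Missing.boltzmann P β (fun b : PBond P 0 => U (b.src, b.dir)) =
      Real.exp (-(β / 2) * wilsonAction (d := P.d) (L := P.sitesPerDir 0) (fundamentalRep (Fin 2)) U) := by
  rw [Missing.boltzmann, neg_mul, neg_mul, mul_wilsonAction4_pullback]

/-- **The expectation dictionary** (every real `β`, every `f`): Bałaban's
`expect P β f = ∫ f e^{−βA} / ∫ e^{−βA}` equals `∫ f(U ∘ dict) d(wilsonMeasure (fundamentalRep (Fin 2)) (β/2))(U)`.
[folklore] -/
theorem expect_eq_integral_wilsonMeasure (β : ℝ) (f : GaugeField P 0 (Matrix.specialUnitaryGroup (Fin 2) ℂ) → ℝ) :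
    Missing.expect P β f =
      ∫ U, f (fun b : PBond P 0 => U (b.src, b.dir))
        ∂(wilsonMeasure (d := P.d) (L := P.sitesPerDir 0) (fundamentalRep (Fin 2)) (β / 2)) := by
  have h := wilsonExpectation_eq_integral_div (d := P.d) (L := P.sitesPerDir 0)
    (G := Matrix.specialUnitaryGroup (Fin 2) ℂ) (ρ := fundamentalRep (Fin 2)) (continuous_fundamentalRep (Fin 2)) (β / 2)
    (fun U => f (fun b : PBond P 0 => U (b.src, b.dir)))
  rw [wilsonExpectation] at h
  rw [h, Missing.expect, Missing.partitionFn]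
  have hhaar : (haarProbability (Matrix.specialUnitaryGroup (Fin 2) ℂ)) =
      (HaarData.haar : Measure (Matrix.specialUnitaryGroup (Fin 2) ℂ)) := rfl
  rw [hhaar]
  congr 1
  · rw [← integral_pullback P (fun V => f V * Missing.boltzmann P β V)]
    refine integral_congr_ae (ae_of_all _ fun U => ?_)
    simp only [boltzmann_pullback]
  · rw [← integral_pullback P (fun V => Missing.boltzmann P β V)]
    refine integral_congr_ae (ae_of_all _ fun U => ?_)
    simp only [boltzmann_pullback]

end SU2

/-! ### The rung's input (D), verbatim -/

/-- **(D) the Gibbs dictionary for the route's scheme**: for every admissible family `F`, coupling `γ`, step `K`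
and loop string `os`, Bałaban's `expectAt K os` (scheme `F.scheme expMeanLogSU γ`, `β_K = (γ ε_K)⁻¹`) is the
`wilsonMeasure (fundamentalRep (Fin 2)) ((γ ε_K)⁻¹/2)`-integral of the product of the averaged loop variables
read through `b ↦ (b.src, b.dir)` — hypothesis `hDict` of `fixedCutoffMixing_of_latticeErgodic`, now a theorem. -/
theorem expectAt_eq_integral_wilsonMeasure (F : T3ContinuumYM3Torus.T3Family) (γ : ℝ) (K : ℕ)
    (os : List (T3ContinuumYM3Torus.ULoop3 F)) :
    (F.scheme (ExpMeanLog.expMeanLogSU : LoopAverage (Matrix.specialUnitaryGroup (Fin 2) ℂ)) γ).expectAt K os =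
      ∫ V, (os.map fun C => F.avgObs (ExpMeanLog.expMeanLogSU :
          LoopAverage (Matrix.specialUnitaryGroup (Fin 2) ℂ)) K C
        (fun b : PBond (F.P K) 0 => V (b.src, b.dir))).prod
        ∂(wilsonMeasure (d := 3) (L := (F.P K).sitesPerDir 0) (fundamentalRep (Fin 2)) ((γ * (F.P K).eps)⁻¹ / 2)) :=
  expect_eq_integral_wilsonMeasure (F.P K) ((γ * (F.P K).eps)⁻¹) _

end Summit.QuantumFields.YangMills.Theorems.ColdStartUniversality

end
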